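import Summits.BirchSwinnertonDyer.BirchSwinnertonDyer.Theorems.GenusKolyvaginAtTwoPowDvdShaCardAtTwoRTExactEigenFunctionalLaw
import Summits.BirchSwinnertonDyer.BirchSwinnertonDyer.Theorems.GenusKolyvaginAtTwoPowDvdShaCardAtTwoPosTTranspositionFrame
import HarnessLib

/-!
# Route `GenusKolyvaginAtTwo`, crux L⁺_T `PowDvdShaCardAtTwoPosT` (stmt-BirchSwinnertonDyer-23379), road (E4)⁺, socket swap⁺ —
# THE EXACT ORDER OF AN `s`-EIGEN FUNCTIONAL ON THE LOCAL KUMMER GROUP AT A TRANSPOSITION-DEEP KOLYVAGIN PLACE, SIGN-FREE IN `Δ`: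
# `addOrderOf (Φ u) = 2^(N_u + N_Φ − (k+1))` — gk2-p3 g23's `…RTExactEigenFunctionalLaw` with `Δ < 0 ∧ FrobEqFrobInfty` ↦ the transposition clause

Seat `bsd-line-gk2-p5` g32 (WIDTH-5 attach, cell `bsd-f1-sign2`), `--supports stmt-BirchSwinnertonDyer-23379` (helper; closes nothing).
THEOREMS ONLY (no definition, no named fact, no `sorry`).  BSD is NOT proved by any of this; neither is L⁺_T nor any stub.

WHY (LEAD gk2-p1 g20 memo `Cruxes/KolyvaginExactAtTwoPosDiscT/R10-LPLUS-ROAD-E4POS-g20.md`, §0.3 «swap⁺»; LEAD ruling R10′).  Road (E4) closed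
L_T on `Δ < 0` (p744020); its KS socket `hswap` = LEAD g18's exact prime swap `PlusDescent.deepSwap_socket` (`…RTExactSwapHybridFrob`), whose two
EXACT local laws P7a⁼/P7b⁼ (`…RTExactSwapLawKummer` / `…RTExactSwapLawTransverse`, gk2-p3 g23) rest on ONE local core,
`kummer_eigenFunctional_addOrderOf_at_two` (`…RTExactEigenFunctionalLaw`), and that core touches `Δ < 0` / Gross's `FrobEqFrobInfty` at exactly
ONE point: the regular frame `exists_regular_frame_liftAutPlace` of the adapted lift `τ̃_*` on `E[2^k](K̄)`.  gk2-p2 g22's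
`…PosTTranspositionFrame.exists_regular_frame_liftAutPlace_of_transposition` proves the SAME frame, for either sign of `Δ`, from the
TRANSPOSITION clause «some arithmetic Frobenius above `ℓ` moves a point of `E[2]`» (the regular Čebotarev class of LINE 16_T / gk2-p4 g23's
Part C).  THIS FILE is the local core re-cut on that clause — statements VERBATIM those of `…RTExactEigenFunctionalLaw` §2 with the binders
`(hΔ : W.Δ < 0)`, `(hF : FrobEqFrobInfty W K (2 ^ M') ℓ)`, `(hkM' : k ≤ M')` replaced by
`(hR : ∃ v 𝔓 h, (ℓ : 𝓞 ℚ) ∈ v.asIdeal ∧ 𝔓 ∈ v.primesAbove ∧ IsArithFrobAt (𝓞 ℚ) h 𝔓 ∧ ∃ u : E[2], h • u ≠ u)`; proofs verbatim with the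
frame call swapped (the pure-algebra step `eigenFunctional_addOrderOf_eval` is imported, not restated):
* `kummer_eigenFunctional_addOrderOf_at_two_of_transposition` — `addOrderOf (Φ u) = 2^(N_u + N_Φ − (k+1))`;
* `kummer_eigenFunctional_pow_smul_ne_zero_at_two_of_transposition` — exact P7a, local form;
* `kummer_eigenFunctional_pow_smul_eq_zero_at_two_of_transposition` — exact P7b, local Kummer form;
Consistency: on `Δ < 0` the original hypotheses give the transposition clause (`transposition_of_frobEqFrobInfty_of_Δ_neg` ∘
`frobEqFrobInfty_two_of_two_pow`, gk2-p2 g22), so gk2-p3's `Δ < 0` law is literally the `Δ < 0` case of the sign-free one (not restated here: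
the specialisation has the landed theorem's type, `dedup.landed`).
Sequel (this seat): P7a⁼/P7b⁼, the deep pair Čebotarev, `exactSwap_core`, `deepSwap_socket` at transposition-deep primes.

References: [Kolyvagin1991MathAnn] §2 (proof of Thm. 2.2), Thm. 2.1; [McCallumLMS1991] §4 Prop. 4.4, §5 Lemma 5.3 and (13);
[GrossLMS1991] §3 (3.2)–(3.3), Prop. 6.2; [Jetchev2008] §3.2 (2)–(3), Prop. 4.2.
-/

set_option autoImplicit false

noncomputable section

open scoped Classical
open Function Field NumberField IsDedekindDomain WeierstrassCurve
open Literature.NumberTheory.EllipticCurves Literature.NumberTheory.GaloisRepresentations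
open Literature.NumberTheory.GaloisCohomology
open Literature.NumberTheory.Automorphic
open Summit.BirchSwinnertonDyer.Rank1Residual.X11b.Relaxation
open Summit.BirchSwinnertonDyer.Rank1Residual.JET.GlobalDuality

-- the Theorems namespace of this sub repeats the summit name by design (D-0017 nested layout)
set_option linter.dupNamespace false

namespace Summit.BirchSwinnertonDyer.BirchSwinnertonDyer.Theorems.GenusExact.PlusDescent


/-! ## §1 The exact law on the local Kummer group at a transposition-deep Kolyvagin place (any sign of `Δ`) -/

variable (W : WeierstrassCurve ℚ) (K : Type) [Field K] [NumberField K] [W.IsElliptic] [W.IsGloballyMinimal]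

/-- **THE EXACT ORDER OF AN `s`-EIGEN FUNCTIONAL ON `Kum_v` (transposition-deep Kolyvagin place, ANY sign of `Δ`).**  `K` imaginary
quadratic, `τ ≠ 1`; `ℓ` a Zhang–Kolyvagin prime at `2` with `1 ≤ k ≤ M(ℓ)` some arithmetic Frobenius above which moves a point of `E[2]`;
`v ∋ ℓ`, `τ • v = v`; `Φ` an additive map on `H¹(K_v, E[2^k])` into a group killed by `2^k` with `Φ(σ_* a) = s Φ(a)` on `Kum_v`
(`σ_* = conjActPlace`, `s = ±1`); `u ∈ Kum_v` with `σ_* u = s u`.  Then there are exponents `N_u`, `N_Φ` with `addOrderOf u = 2^{N_u}`,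
`2^{N_Φ} Φ(Kum_v) = 0` attained at some `a₁ ∈ Kum_v`, and **`addOrderOf (Φ u) = 2^(N_u + N_Φ − (k + 1))`** — exactly one bit is lost.
(= gk2-p3 g23's `kummer_eigenFunctional_addOrderOf_at_two`, proof verbatim, frame from `exists_regular_frame_liftAutPlace_of_transposition`.)
[cite: Kolyvagin1991MathAnn, §2 (proof of Thm. 2.2)] [cite: McCallumLMS1991, §5 Lemma 5.3 and (13)] [cite: GrossLMS1991, §3 (3.2)–(3.3)] -/
theorem kummer_eigenFunctional_addOrderOf_at_two_of_transposition (hK : IsImaginaryQuadratic K) {k ℓ : ℕ} (hk1 : 1 ≤ k)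
    (hℓ : Zhang2014.IsKolyvaginPrime (W.conductorNorm ℤ) W K 2 ℓ)
    (hk : k ≤ Zhang2014.kolyvaginIndex W 2 ℓ)
    (hR : ∃ (v : HeightOneSpectrum (𝓞 ℚ)) (𝔓 : Ideal (absIntegers (𝓞 ℚ) ℚ)) (h : absoluteGaloisGroup ℚ),
      (ℓ : 𝓞 ℚ) ∈ v.asIdeal ∧ 𝔓 ∈ v.primesAbove ∧ IsArithFrobAt (𝓞 ℚ) h 𝔓 ∧ ∃ u : geomTorsion W 2, h • u ≠ u)
    (v : HeightOneSpectrum (𝓞 K)) (hv : (ℓ : 𝓞 K) ∈ v.asIdeal)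
    {τ : K ≃ₐ[ℚ] K} (hτ1 : τ ≠ 1) (hfix : τ • v = v) {s : ℤ} (hs : s = 1 ∨ s = -1)
    {C : Type*} [AddCommGroup C] (hC : ∀ c : C, (2 : ℤ) ^ k • c = 0)
    (Φ : galoisCohomology
        (((W.baseChange K).torsionGaloisModule ((2 ^ k : ℕ) : ℤ)).toLocal (Sum.inr v : Place K)) 1 →+ C)
    (hΦ : ∀ a ∈ (W.baseChange K).kummerSelmerStructure ((2 ^ k : ℕ) : ℤ) (Sum.inr v : Place K),
      Φ (conjActPlace W τ ((2 ^ k : ℕ) : ℤ) hfix a) = s • Φ a)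
    {u : galoisCohomology
        (((W.baseChange K).torsionGaloisModule ((2 ^ k : ℕ) : ℤ)).toLocal (Sum.inr v : Place K)) 1}
    (huK : u ∈ (W.baseChange K).kummerSelmerStructure ((2 ^ k : ℕ) : ℤ) (Sum.inr v : Place K))
    (hu : conjActPlace W τ ((2 ^ k : ℕ) : ℤ) hfix u = s • u) :
    ∃ Nu NΦ : ℕ, addOrderOf u = 2 ^ Nu ∧
      (∀ a ∈ (W.baseChange K).kummerSelmerStructure ((2 ^ k : ℕ) : ℤ) (Sum.inr v : Place K), (2 : ℤ) ^ NΦ • Φ a = 0) ∧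
      (∃ a₁ ∈ (W.baseChange K).kummerSelmerStructure ((2 ^ k : ℕ) : ℤ) (Sum.inr v : Place K), addOrderOf (Φ a₁) = 2 ^ NΦ) ∧
      addOrderOf (Φ u) = 2 ^ (Nu + NΦ - (k + 1)) := by
  haveI : Fact (Nat.Prime 2) := ⟨Nat.prime_two⟩
  set σ := conjActPlace W τ ((2 ^ k : ℕ) : ℤ) hfix with hσdef
  set t := (isLiftOfAut_liftAutPlace τ hfix).torsionMap W ((2 ^ k : ℕ) : ℤ) with htdef
  -- good reduction and `2 ∉ λ`
  obtain ⟨hgood, hpw⟩ := hasGoodReductionAt_of_zhangKolyvaginPrime W K hℓ v hv 1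
  have hpw' : ((2 : ℕ) : 𝓞 K) ∉ v.asIdeal := by rwa [pow_one, Int.cast_natCast] at hpw
  -- the unramified parametrisation and the regular frame
  obtain ⟨unr, hunr0, hunrL, hLunr, hunr⟩ :=
    exists_unramified_parametrization_kummer W K hK hℓ hk v hv hpw' hgood τ hfix
  obtain ⟨Q₀, htor, hspan, hfree, ht⟩ := exists_regular_frame_liftAutPlace_of_transposition W K hK hk1 hℓ hk hR v hv hτ1 hfix
  -- the functional pulled back to `E[2^k](K̄)`
  set ψ : geomTorsion (W.baseChange K) ((2 ^ k : ℕ) : ℤ) →+ C := Φ.comp unr with hψdef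
  have hψapp : ∀ Q, ψ Q = Φ (unr Q) := fun Q ↦ rfl
  have hψ : ∀ Q, ψ (t Q) = s • ψ Q := fun Q ↦ by
    rw [hψapp, hψapp, hunr, hΦ _ (hunrL Q)]
  -- `u = unr P` with `t P = s P`
  obtain ⟨P, hP⟩ := hLunr u huK
  have htP : t P = s • P := by
    apply hunr0
    rw [hunr, hP, hu, map_zsmul, hP]
  -- the exponents
  have h2P : (2 ^ k) • P = 0 := by simpa using (W.baseChange K).natAbs_nsmul_geomTorsion P
  obtain ⟨Nu, -, hNu⟩ := (Nat.dvd_prime_pow Nat.prime_two).mp (addOrderOf_dvd_iff_nsmul_eq_zero.mpr h2P)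
  have h2ψ : (2 ^ k) • ψ Q₀ = 0 := by rw [← two_zpow_smul_eq_nsmul]; exact hC _
  obtain ⟨NΦ, -, hNΦ⟩ := (Nat.dvd_prime_pow Nat.prime_two).mp (addOrderOf_dvd_iff_nsmul_eq_zero.mpr h2ψ)
  -- every value of `Φ` on `Kum_v` is an integer multiple of `ψ Q₀`
  have hmult : ∀ a ∈ (W.baseChange K).kummerSelmerStructure ((2 ^ k : ℕ) : ℤ) (Sum.inr v : Place K),
      ∃ c : ℤ, Φ a = c • ψ Q₀ := by
    intro a ha
    obtain ⟨Q, rfl⟩ := hLunr a ha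
    obtain ⟨c₁, c₂, rfl⟩ := hspan Q
    refine ⟨c₁ + c₂ * s, ?_⟩
    rw [← hψapp, map_add, map_zsmul, map_zsmul, hψ, add_zsmul, mul_zsmul]
  refine ⟨Nu, NΦ, ?_, ?_, ⟨unr Q₀, hunrL Q₀, ?_⟩, ?_⟩
  · rw [← hP]; exact (addOrderOf_injective unr hunr0 P).trans hNu
  · intro a ha
    obtain ⟨c, hc⟩ := hmult a ha
    rw [hc, smul_comm, two_zpow_smul_eq_nsmul, ← hNΦ, addOrderOf_nsmul_eq_zero, zsmul_zero]
  · rw [← hψapp]; exact hNΦ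
  · rw [← hP, ← hψapp]
    exact eigenFunctional_addOrderOf_eval t ht Q₀ hspan hfree htor ψ hs hψ htP
      ((addOrderOf_injective unr hunr0 P).symm.trans ((addOrderOf_injective unr hunr0 P).trans hNu)) hNΦ

/-- **EXACT P7a, LOCAL FORM, at a transposition-deep place (any sign of `Δ`)** (KRR's `kummer_eval_pow_smul_ne_zero_at_two`, one bit
sharper): in the setting of `kummer_eigenFunctional_addOrderOf_at_two_of_transposition`, `2^i u ≠ 0`, `∃ a ∈ Kum_v, 2^j Φ a ≠ 0` and
`k ≤ i + j` give **`2^(i + j − k) • Φ u ≠ 0`**. [cite: Kolyvagin1991MathAnn, §2 (proof of Thm. 2.2)] [cite: Jetchev2008, §3.2 (2)–(3), Prop. 4.2] -/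
theorem kummer_eigenFunctional_pow_smul_ne_zero_at_two_of_transposition (hK : IsImaginaryQuadratic K) {k ℓ : ℕ} (hk1 : 1 ≤ k)
    (hℓ : Zhang2014.IsKolyvaginPrime (W.conductorNorm ℤ) W K 2 ℓ)
    (hk : k ≤ Zhang2014.kolyvaginIndex W 2 ℓ)
    (hR : ∃ (v : HeightOneSpectrum (𝓞 ℚ)) (𝔓 : Ideal (absIntegers (𝓞 ℚ) ℚ)) (h : absoluteGaloisGroup ℚ),
      (ℓ : 𝓞 ℚ) ∈ v.asIdeal ∧ 𝔓 ∈ v.primesAbove ∧ IsArithFrobAt (𝓞 ℚ) h 𝔓 ∧ ∃ u : geomTorsion W 2, h • u ≠ u)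
    (v : HeightOneSpectrum (𝓞 K)) (hv : (ℓ : 𝓞 K) ∈ v.asIdeal)
    {τ : K ≃ₐ[ℚ] K} (hτ1 : τ ≠ 1) (hfix : τ • v = v) {s : ℤ} (hs : s = 1 ∨ s = -1)
    {C : Type*} [AddCommGroup C] (hC : ∀ c : C, (2 : ℤ) ^ k • c = 0)
    (Φ : galoisCohomology
        (((W.baseChange K).torsionGaloisModule ((2 ^ k : ℕ) : ℤ)).toLocal (Sum.inr v : Place K)) 1 →+ C)
    (hΦ : ∀ a ∈ (W.baseChange K).kummerSelmerStructure ((2 ^ k : ℕ) : ℤ) (Sum.inr v : Place K),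
      Φ (conjActPlace W τ ((2 ^ k : ℕ) : ℤ) hfix a) = s • Φ a)
    {u : galoisCohomology
        (((W.baseChange K).torsionGaloisModule ((2 ^ k : ℕ) : ℤ)).toLocal (Sum.inr v : Place K)) 1}
    (huK : u ∈ (W.baseChange K).kummerSelmerStructure ((2 ^ k : ℕ) : ℤ) (Sum.inr v : Place K))
    (hu : conjActPlace W τ ((2 ^ k : ℕ) : ℤ) hfix u = s • u) {i j : ℕ} (hi : (2 : ℤ) ^ i • u ≠ 0)
    (hj : ∃ a ∈ (W.baseChange K).kummerSelmerStructure ((2 ^ k : ℕ) : ℤ) (Sum.inr v : Place K), (2 : ℤ) ^ j • Φ a ≠ 0)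
    (hg : k ≤ i + j) :
    (2 : ℤ) ^ (i + j - k) • Φ u ≠ 0 := by
  obtain ⟨Nu, NΦ, hNu, hΦ0, -, hord⟩ :=
    kummer_eigenFunctional_addOrderOf_at_two_of_transposition W K hK hk1 hℓ hk hR v hv hτ1 hfix hs hC Φ hΦ huK hu
  -- `i < N_u` and `j < N_Φ`
  have hiN : i < Nu := by
    by_contra h
    exact hi ((two_zpow_smul_eq_zero_iff_of_addOrderOf hNu i).mpr (not_lt.mp h))
  have hjN : j < NΦ := by
    obtain ⟨a, ha, hja⟩ := hj
    by_contra h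
    apply hja
    obtain ⟨d, hd⟩ := Nat.exists_eq_add_of_le (not_lt.mp h)
    rw [hd, pow_add, mul_comm, mul_zsmul, hΦ0 a ha, zsmul_zero]
  rw [Ne, two_zpow_smul_eq_zero_iff_of_addOrderOf hord]
  omega

/-- **EXACT P7b, LOCAL KUMMER FORM, at a transposition-deep place (any sign of `Δ`)**: in the setting of
`kummer_eigenFunctional_addOrderOf_at_two_of_transposition`, `2^i u = 0` and `∀ a ∈ Kum_v, 2^j Φ a = 0` give
**`2^(i + j − k − 1) • Φ u = 0`** (one bit sharper than the free-module bound `2^(i + j − k)`).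
[cite: Kolyvagin1991MathAnn, §2 (proof of Thm. 2.2)] [cite: McCallumLMS1991, §5 (13)] -/
theorem kummer_eigenFunctional_pow_smul_eq_zero_at_two_of_transposition (hK : IsImaginaryQuadratic K) {k ℓ : ℕ} (hk1 : 1 ≤ k)
    (hℓ : Zhang2014.IsKolyvaginPrime (W.conductorNorm ℤ) W K 2 ℓ)
    (hk : k ≤ Zhang2014.kolyvaginIndex W 2 ℓ)
    (hR : ∃ (v : HeightOneSpectrum (𝓞 ℚ)) (𝔓 : Ideal (absIntegers (𝓞 ℚ) ℚ)) (h : absoluteGaloisGroup ℚ),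
      (ℓ : 𝓞 ℚ) ∈ v.asIdeal ∧ 𝔓 ∈ v.primesAbove ∧ IsArithFrobAt (𝓞 ℚ) h 𝔓 ∧ ∃ u : geomTorsion W 2, h • u ≠ u)
    (v : HeightOneSpectrum (𝓞 K)) (hv : (ℓ : 𝓞 K) ∈ v.asIdeal)
    {τ : K ≃ₐ[ℚ] K} (hτ1 : τ ≠ 1) (hfix : τ • v = v) {s : ℤ} (hs : s = 1 ∨ s = -1)
    {C : Type*} [AddCommGroup C] (hC : ∀ c : C, (2 : ℤ) ^ k • c = 0)
    (Φ : galoisCohomology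
        (((W.baseChange K).torsionGaloisModule ((2 ^ k : ℕ) : ℤ)).toLocal (Sum.inr v : Place K)) 1 →+ C)
    (hΦ : ∀ a ∈ (W.baseChange K).kummerSelmerStructure ((2 ^ k : ℕ) : ℤ) (Sum.inr v : Place K),
      Φ (conjActPlace W τ ((2 ^ k : ℕ) : ℤ) hfix a) = s • Φ a)
    {u : galoisCohomology
        (((W.baseChange K).torsionGaloisModule ((2 ^ k : ℕ) : ℤ)).toLocal (Sum.inr v : Place K)) 1}
    (huK : u ∈ (W.baseChange K).kummerSelmerStructure ((2 ^ k : ℕ) : ℤ) (Sum.inr v : Place K))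
    (hu : conjActPlace W τ ((2 ^ k : ℕ) : ℤ) hfix u = s • u) {i j : ℕ} (hi : (2 : ℤ) ^ i • u = 0)
    (hj : ∀ a ∈ (W.baseChange K).kummerSelmerStructure ((2 ^ k : ℕ) : ℤ) (Sum.inr v : Place K), (2 : ℤ) ^ j • Φ a = 0) :
    (2 : ℤ) ^ (i + j - k - 1) • Φ u = 0 := by
  obtain ⟨Nu, NΦ, hNu, -, ⟨a₁, ha₁, hNΦ⟩, hord⟩ :=
    kummer_eigenFunctional_addOrderOf_at_two_of_transposition W K hK hk1 hℓ hk hR v hv hτ1 hfix hs hC Φ hΦ huK hu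
  have hiN : Nu ≤ i := (two_zpow_smul_eq_zero_iff_of_addOrderOf hNu i).mp hi
  have hjN : NΦ ≤ j := (two_zpow_smul_eq_zero_iff_of_addOrderOf hNΦ j).mp (hj a₁ ha₁)
  rw [two_zpow_smul_eq_zero_iff_of_addOrderOf hord]
  omega

end Summit.BirchSwinnertonDyer.BirchSwinnertonDyer.Theorems.GenusExact.PlusDescent

end
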